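import Literature.Computability.Cryptography.RegevReductionTT
import Literature.Computability.Cryptography.LWEAmplification
import HarnessLib

/-!
# Regev's quantum reduction, `GapSVP` form, IV: the assembly from Thm 3.1 (printed form) and Lemma 3.20 alone

Topic `Computability/Cryptography` (family `pqc`). Running tally of the discharge of the named fact
`Literature.Computability.Cryptography.regev_lwe_to_gapSVP_quantum` (pqc.S19, GapSVP form; Regev,
J. ACM 56 (2009), Thm 1.1 with §3.3). The proved assembly
`regev_lwe_to_gapSVP_quantum_of_worstCase_tt (h₁) (h₂) (hL)` (`RegevReductionTT.lean`) takes

* `h₁` — the average-case-to-worst-case bridge for search-`LWE` (Regev 2009, §2 p. 12 with the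
  shift of the proof of Lemma 4.1), now the THEOREM `Regev2009.searchLWE_worstCase_of_avgCase`
  (`LWEAmplification.lean`);
* `h₂` — Regev's Thm 3.1 in its printed worst-case-oracle form (with Lemma 4.3), shared verbatim
  with the SIVP form (`regev_lwe_to_sivp_quantum_of_thm31_of_lemma317`, `LWEAmplification.lean`);
* `hL` — Lemma 3.20 in machine form (`DGS_{√n γ/λ₁(L*)}` sampler ⇒ `GapCVP′_{100√n γ}` decider; its
  mathematics is `Algebra/EuclideanLattices/ARVerifierRandomWitness.lean`, `RegevDualQuery.lean`).

This file feeds `h₁` in: **`regev_lwe_to_gapSVP_quantum_of_thm31_of_lemma320 (h₂) (hL)`** — pqc.S19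
(GapSVP form) from exactly two printed results of the paper, Thm 3.1 and Lemma 3.20, both in
machine form. (The [GMSS99] step `hG` is the theorem `Regev2009.gmss_gapSVP_of_gapCVP'_quantum` of
`RegevReductionTT.lean`; the bookkeeping `γ = max 1 (100√n · max 1 (√(2n)/α)) = O(n/α)` and the
Lemma 2.11 step are in `RegevReduction.lean`.) Once `h₂` and `hL` are theorems of the tree,
`regev_lwe_to_gapSVP_quantum_holds` is this assembly applied to them.

Everything here is PROVED; no named fact is introduced.

## References

* O. Regev, *On lattices, learning with errors, random linear codes, and cryptography*, J. ACM 56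
  (2009), art. 34 (arXiv:2401.03703): Thm 1.1, §2 (p. 12), Thm 3.1, Lemma 3.20, §3.3 (p. 21),
  Lemma 4.1 (proof), Lemma 4.3 [Regev2009].
-/

noncomputable section

open Filter Literature.Computability.Complexity Literature.Computability.Cryptography.LWE
  Literature.Algebra.EuclideanLattices

namespace Literature.Computability.Cryptography

section TwoChildren

variable (q : ℕ → ℕ) [∀ n, NeZero (q n)] (α : ℕ → ℝ) (m : ℕ → ℕ)

/-- **pqc.S19 (GapSVP form) from TWO printed results.** With the average-case bridge `h₁` a theorem
(`Regev2009.searchLWE_worstCase_of_avgCase`) and the [GMSS99] step a theorem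
(`Regev2009.gmss_gapSVP_of_gapCVP'_quantum`), the assembly
`regev_lwe_to_gapSVP_quantum_of_worstCase_tt` needs only Regev's Thm 3.1 in its printed
worst-case-oracle form (`h₂`, verbatim the `h₂` of the SIVP form
`regev_lwe_to_sivp_quantum_of_thm31_of_lemma317`) and Lemma 3.20 in machine form (`hL`, verbatim the
`hL` of `regev_lwe_to_gapSVP_quantum_of_dgs`). [cite: Regev2009, Thm 1.1 from Thm 3.1, Lemma 3.20 and §3.3 (GMSS99)] -/
theorem regev_lwe_to_gapSVP_quantum_of_thm31_of_lemma320
    (h₂ : ∀ (m' : ℕ → ℕ) (_ : IsPolyBounded m') (_ : IsPolyTimeParams q α m')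
      (_ : ∀ᶠ n : ℕ in atTop, 0 < α n ∧ α n < 1 ∧ 2 * Real.sqrt n < α n * q n)
      (_ : ∃ (W : UniformQCircuitFamily) (c : ℝ), 0 < c ∧
        W.SolvesSearchLWEWorstCase q (fun n => discretizedGaussian (q n) (α n)) m'
          fun n => (2 : ℝ) ^ (-(c * n)))
      (ε : ℕ → ℝ), IsNegligible ε → (∀ n, 0 < ε n) →
      ∃ (D : UniformQCircuitFamily) (ν : ℕ → ℝ), IsNegligible ν ∧ D.SamplesDGS (regevDGSBound α ε) ν)
    (hL : ∀ (γ : ℕ → ℝ), (∀ n, 1 ≤ γ n) →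
      (∃ (D : UniformQCircuitFamily) (ν : ℕ → ℝ),
          IsNegligible ν ∧ D.SamplesDGS (Regev2009.dgsBoundDual γ) ν) →
      ∃ Q : UniformQCircuitFamily, ∀ᶠ n : ℕ in atTop, ∀ p : GapCVPInstance, p.1.I.n = n →
        (p ∈ GapCVP'.yes (fun k => 100 * Real.sqrt k * γ k) → 2 / 3 ≤ Q.acceptProb p.encode) ∧
        (p ∈ GapCVP'.no (fun k => 100 * Real.sqrt k * γ k) → Q.acceptProb p.encode ≤ 1 / 3)) :
    regev_lwe_to_gapSVP_quantum q α m :=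
  regev_lwe_to_gapSVP_quantum_of_worstCase_tt q α m (Regev2009.searchLWE_worstCase_of_avgCase q α m) h₂ hL

end TwoChildren

end Literature.Computability.Cryptography

end
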